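import Summits.HodgeConjecture.HodgeCM.Model.ArchKTypeOfSA_1

/-! PORT of `HodgeCM/Model/ArchKTypeOfSA.lean` (HodgeCMPerL run 82) — part 2: continuation of `Summits.HodgeConjecture.HodgeCM.Model.ArchKTypeOfSA_1` (split at a top-level declaration boundary by port_pkg.py; scope re-opened below; declarations unchanged). -/

-- port_pkg: scope re-opened for this part (file-level context, then the namespace/section stack open at the cut)
set_option autoImplicit false
noncomputable section
open Filter Topology Complex
open NumberField NumberField.InfinitePlace NumberField.mixedEmbedding IsDedekindDomain MeasureTheory
open scoped Matrix TensorProduct Classical SchwartzMap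
open MulAction
open Literature.Geometry.ComplexHyperbolic.BallModel (U21 x₀ stabilizerEquivK21)
open Literature.NumberTheory.Automorphic.U21 (K21 matA sclD)
open Literature.AlgebraicGeometry.HodgeTheory
open Literature.AlgebraicGeometry.ShimuraVarieties Literature.AlgebraicGeometry.ShimuraVarieties.BallForms
open Literature.NumberTheory.Automorphic Literature.NumberTheory.Weil1964
open Literature.RepresentationTheory.KonnoKonno2007 Literature.RepresentationTheory.KonnoKonno2007.RealDualPair
open Literature.NumberTheory.GelbartRogawski1991 Literature.NumberTheory.GelbartRogawski1991.UnitaryDualPair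
open Literature.Analysis.SegalBargmann Literature.Analysis.Distribution
open Literature.NumberTheory.Automorphic.PicardCM
open HodgeCM.Adelic HodgeCM.PerL34 HodgeCM.Model.HypCensus HodgeCM.Model.SupplyInstance HodgeCM.Model.ArchSideTerm
namespace HodgeCM.Model
section SA
variable (hHD : exists_isReal_hodgeModel) (hI : hodgePQ_independent_of_hodgeModel)
  (h₁ : BallQuotientUniformised)  (h₃ : CMAbelianVarietyRealised)
variable
  (hGR : ∀ {L : CMField} {ι₁ : L →+* ℂ} (V : HermSpace3 L ι₁) (c : SeesawCtx L),
    (cmSplittingDatum (L : Type) finProdFinEquiv (frameD V) (frameD_real V) (frameD_ne V) (dW c.D) (dW_real c.D)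
      (dW_ne c.D)).CompatibleSplitting)
  (η : ∀ {L : CMField} {ι₁ : L →+* ℂ} (V : HermSpace3 L ι₁) (c : SeesawCtx L),
    CMAdelic (L : Type) (frameD V) × CMAdelic (L : Type) (dW c.D) →* ℂˣ)
  (hη : ∀ {L : CMField} {ι₁ : L →+* ℂ} (V : HermSpace3 L ι₁) (c : SeesawCtx L),
    ∀ γU ∈ CMRat (L : Type) (frameD V), ∀ γ ∈ CMRat (L : Type) (dW c.D), η V c (γU, γ) = 1)
  (hηc : ∀ {L : CMField} {ι₁ : L →+* ℂ} (V : HermSpace3 L ι₁) (c : SeesawCtx L), Continuous fun p => ((η V c p : ℂˣ) : ℂ))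
  (hGR₀ : ∀ {L : CMField} {ι₁ : L →+* ℂ} (V : HermSpace3 L ι₁) (c : SeesawCtx L),
    (cmSplittingDatum (L : Type) (e₁) (frameD V) (frameD_real V) (frameD_ne V) (lineVec (L : Type) (dW c.D 0))
      (fun _ => dW_real c.D 0) (fun _ => dW_ne c.D 0)).CompatibleSplitting)
  (hGR₁ : ∀ {L : CMField} {ι₁ : L →+* ℂ} (V : HermSpace3 L ι₁) (c : SeesawCtx L),
    (cmSplittingDatum (L : Type) (e₁) (frameD V) (frameD_real V) (frameD_ne V) (lineVec (L : Type) (dW c.D 1))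
      (fun _ => dW_real c.D 1) (fun _ => dW_ne c.D 1)).CompatibleSplitting)
  (hGR₂ : ∀ {L : CMField} {ι₁ : L →+* ℂ} (V : HermSpace3 L ι₁) (c : SeesawCtx L),
    (cmSplittingDatum (L : Type) (e₁) (frameD V) (frameD_real V) (frameD_ne V) (lineVec (L : Type) (dW' c.D 0))
      (fun _ => dW'_real c.D 0) (fun _ => dW'_ne c.D 0)).CompatibleSplitting)
  (hGR₃ : ∀ {L : CMField} {ι₁ : L →+* ℂ} (V : HermSpace3 L ι₁) (c : SeesawCtx L),
    (cmSplittingDatum (L : Type) (e₁) (frameD V) (frameD_real V) (frameD_ne V) (lineVec (L : Type) (dW' c.D 1))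
      (fun _ => dW'_real c.D 1) (fun _ => dW'_ne c.D 1)).CompatibleSplitting)
  (μ : ∀ {L : CMField}, SeesawCtx L → Fin 4 → NumberField.InfinitePlace L → ℤ)
  (𝔄 : ∀ {L : CMField} {ι₁ : L →+* ℂ} (V : HermSpace3 L ι₁) (c : SeesawCtx L),
    ArchLineDatum V c.D (hGR V c) (hGR₀ V c) (hGR₁ V c) (hGR₂ V c) (hGR₃ V c) (η V c) (μ c))
variable {L : CMField} {ι₁ : L →+* ℂ} (V : HermSpace3 L ι₁) (c : SeesawCtx L) (hV : IsAnisotropic L V.Hm)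
section Dispatch
variable (hemb : (InfinitePlace.mk ι₁).embedding = ι₁) (hc : SignRecipe.GoodCtx (orientBitι L ι₁) ι₁ c) (N : ℕ) (Γ₀ : Level V)
variable
  (arch₀₀ : linePhi V (dW c.D 0) (dW_real c.D 0) (dW_ne c.D 0) (hpos_dW₀_SA V c hemb hc) = (𝔄 V c).Φinf 0)
  (harch₀ : ∀ a : UnitaryGroup.arch (↥(maximalRealSubfield L)) L (IsCMField.complexConj L) 3 V.Hm,
    UnitaryGroup.archAt (↥(maximalRealSubfield L)) L (IsCMField.complexConj L) 3 V.Hm (UnitaryGroup.cmPlace (L : Type) ι₁)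
        (NumberField.complexConj_smul_infinitePlace (L : Type) _) (IsCMField.complexConj_ne_one (L : Type)) a = 1 →
    ∀ ℓ, lineRepD V c.D (hGR V c) (hGR₀ V c) (hGR₁ V c) (hGR₂ V c) (hGR₃ V c) (η V c) 0
        (HodgeCM.Adelic.regimeEquiv L V.Hm hV
          (UnitaryGroup.archToAdelic (↥(maximalRealSubfield L)) L (IsCMField.complexConj L) 3 V.Hm a), 1)
        (testFun (↥(maximalRealSubfield L)) (Fin 3)
          (blockFamilyOfAt (L : Type) e₁ (frameD V) (frameD_real V) (frameD_ne V) (lineVec (L : Type) (dW c.D 0))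
            (fun _ => dW_real c.D 0) (fun _ => dW_ne c.D 0) ι₁ (blockPosEquiv V) (blockNegEquiv V)
            (posIdxEquivUnit (hpos_dW₀_SA V c hemb hc)) (negIdxEquivEmpty (hpos_dW₀_SA V c hemb hc)) (degOnePDual Empty) (binvPi 1) ℓ)
          ((𝔄 V c).x₀ 0) N) =
      testFun (↥(maximalRealSubfield L)) (Fin 3)
        (blockFamilyOfAt (L : Type) e₁ (frameD V) (frameD_real V) (frameD_ne V) (lineVec (L : Type) (dW c.D 0))
          (fun _ => dW_real c.D 0) (fun _ => dW_ne c.D 0) ι₁ (blockPosEquiv V) (blockNegEquiv V)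
          (posIdxEquivUnit (hpos_dW₀_SA V c hemb hc)) (negIdxEquivEmpty (hpos_dW₀_SA V c hemb hc)) (degOnePDual Empty) (binvPi 1) ℓ)
        ((𝔄 V c).x₀ 0) N)
  (hfin₀ : ∀ kf : UnitaryGroup.finAdelic (↥(maximalRealSubfield L)) L (IsCMField.complexConj L) 3 V.Hm, kf ∈ Γ₀.K →
    ∀ Φinf : 𝓢((Fin 3 → mixedSpace (↥(maximalRealSubfield L))), ℂ),
      lineRepD V c.D (hGR V c) (hGR₀ V c) (hGR₁ V c) (hGR₂ V c) (hGR₃ V c) (η V c) 0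
          (HodgeCM.Adelic.regimeEquiv L V.Hm hV
            (UnitaryGroup.finAdelicToAdelic (↥(maximalRealSubfield L)) L (IsCMField.complexConj L) 3 V.Hm kf), 1)
          (testFun (↥(maximalRealSubfield L)) (Fin 3) Φinf ((𝔄 V c).x₀ 0) N) =
        testFun (↥(maximalRealSubfield L)) (Fin 3) Φinf ((𝔄 V c).x₀ 0) N)
  (hχ₀ : ∀ u : stabilizer U21 x₀,
    ((lineScalar_zero V c.D (hGR V c) (hGR₀ V c) (hGR₁ V c) (eta₀ V c.D (η V c)) (u : U21) : ℂˣ) : ℂ) *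
        ((matA (stabilizerEquivK21.symm u)).det ^
            (lineVacExponentsZero V c (hGR₀ V c) (h₁W_SA c hc) (posIdxEquivUnit (hpos_dW₀_SA V c hemb hc))
              (negIdxEquivEmpty (hpos_dW₀_SA V c hemb hc))).eP *
          sclD (stabilizerEquivK21.symm u) ^
            (lineVacExponentsZero V c (hGR₀ V c) (h₁W_SA c hc) (posIdxEquivUnit (hpos_dW₀_SA V c hemb hc))
              (negIdxEquivEmpty (hpos_dW₀_SA V c hemb hc))).eQ) =
      star (sclD (stabilizerEquivK21.symm u)))
  (arch₀₁ : linePhi V (dW c.D 1) (dW_real c.D 1) (dW_ne c.D 1) (hpos_dW₁_SA V c hemb hc) = (𝔄 V c).Φinf 1)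
  (harch₁ : ∀ a : UnitaryGroup.arch (↥(maximalRealSubfield L)) L (IsCMField.complexConj L) 3 V.Hm,
    UnitaryGroup.archAt (↥(maximalRealSubfield L)) L (IsCMField.complexConj L) 3 V.Hm (UnitaryGroup.cmPlace (L : Type) ι₁)
        (NumberField.complexConj_smul_infinitePlace (L : Type) _) (IsCMField.complexConj_ne_one (L : Type)) a = 1 →
    ∀ ℓ, lineRepD V c.D (hGR V c) (hGR₀ V c) (hGR₁ V c) (hGR₂ V c) (hGR₃ V c) (η V c) 1
        (HodgeCM.Adelic.regimeEquiv L V.Hm hV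
          (UnitaryGroup.archToAdelic (↥(maximalRealSubfield L)) L (IsCMField.complexConj L) 3 V.Hm a), 1)
        (testFun (↥(maximalRealSubfield L)) (Fin 3)
          (blockFamilyOfAt (L : Type) e₁ (frameD V) (frameD_real V) (frameD_ne V) (lineVec (L : Type) (dW c.D 1))
            (fun _ => dW_real c.D 1) (fun _ => dW_ne c.D 1) ι₁ (blockPosEquiv V) (blockNegEquiv V)
            (posIdxEquivUnit (hpos_dW₁_SA V c hemb hc)) (negIdxEquivEmpty (hpos_dW₁_SA V c hemb hc)) (degOnePDual Empty) (binvPi 1) ℓ)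
          ((𝔄 V c).x₀ 1) N) =
      testFun (↥(maximalRealSubfield L)) (Fin 3)
        (blockFamilyOfAt (L : Type) e₁ (frameD V) (frameD_real V) (frameD_ne V) (lineVec (L : Type) (dW c.D 1))
          (fun _ => dW_real c.D 1) (fun _ => dW_ne c.D 1) ι₁ (blockPosEquiv V) (blockNegEquiv V)
          (posIdxEquivUnit (hpos_dW₁_SA V c hemb hc)) (negIdxEquivEmpty (hpos_dW₁_SA V c hemb hc)) (degOnePDual Empty) (binvPi 1) ℓ)
        ((𝔄 V c).x₀ 1) N)
  (hfin₁ : ∀ kf : UnitaryGroup.finAdelic (↥(maximalRealSubfield L)) L (IsCMField.complexConj L) 3 V.Hm, kf ∈ Γ₀.K →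
    ∀ Φinf : 𝓢((Fin 3 → mixedSpace (↥(maximalRealSubfield L))), ℂ),
      lineRepD V c.D (hGR V c) (hGR₀ V c) (hGR₁ V c) (hGR₂ V c) (hGR₃ V c) (η V c) 1
          (HodgeCM.Adelic.regimeEquiv L V.Hm hV
            (UnitaryGroup.finAdelicToAdelic (↥(maximalRealSubfield L)) L (IsCMField.complexConj L) 3 V.Hm kf), 1)
          (testFun (↥(maximalRealSubfield L)) (Fin 3) Φinf ((𝔄 V c).x₀ 1) N) =
        testFun (↥(maximalRealSubfield L)) (Fin 3) Φinf ((𝔄 V c).x₀ 1) N)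
  (hχ₁ : ∀ u : stabilizer U21 x₀,
    ((lineScalar_one V c.D (hGR V c) (hGR₀ V c) (hGR₁ V c) (eta₁ V c.D (η V c)) (u : U21) : ℂˣ) : ℂ) *
        ((matA (stabilizerEquivK21.symm u)).det ^
            (lineVacExponentsOne V c (hGR₁ V c) (h₁W_SA c hc) (posIdxEquivUnit (hpos_dW₁_SA V c hemb hc))
              (negIdxEquivEmpty (hpos_dW₁_SA V c hemb hc))).eP *
          sclD (stabilizerEquivK21.symm u) ^
            (lineVacExponentsOne V c (hGR₁ V c) (h₁W_SA c hc) (posIdxEquivUnit (hpos_dW₁_SA V c hemb hc))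
              (negIdxEquivEmpty (hpos_dW₁_SA V c hemb hc))).eQ) =
      star (sclD (stabilizerEquivK21.symm u)))
set_option backward.isDefEq.respectTransparency false in
/-- **ROW 14 for it — no further hypothesis.** -/
theorem isWeaklyPDiff_archKTypeOfSA (k : Fin 4) (hk : k = 0 ∨ k = 1) :
    (archKTypeOfSA hHD hI h₁ h₃ hGR η hη hηc hGR₀ hGR₁ hGR₂ hGR₃ μ 𝔄 V c hV hemb hc N Γ₀ arch₀₀ harch₀ hfin₀ hχ₀ arch₀₁ harch₁ hfin₁ hχ₁
      k hk).IsWeaklyPDiff BallForms.expP := by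
  unfold archKTypeOfSA
  split
  · next h0 =>
    subst h0
    exact isWeaklyPDiff_archKTypeOfSAZero hHD hI h₁ h₃ hGR η hη hηc hGR₀ hGR₁ hGR₂ hGR₃ μ 𝔄 V c hV hemb hc N Γ₀ arch₀₀ harch₀ hfin₀ hχ₀
  · next h0 =>
    obtain rfl : k = 1 := hk.resolve_left h0
    exact isWeaklyPDiff_archKTypeOfSAOne hHD hI h₁ h₃ hGR η hη hηc hGR₀ hGR₁ hGR₂ hGR₃ μ 𝔄 V c hV hemb hc N Γ₀ arch₀₁ harch₁ hfin₁ hχ₁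

set_option backward.isDefEq.respectTransparency false in
/-- **ROW 15 for it along `expP` (Along shape of `_r20AE`) — no further hypothesis.** -/
theorem isPMinusKilledAlong_archKTypeOfSA (k : Fin 4) (hk : k = 0 ∨ k = 1) (p : Fin 2) :
    (archKTypeOfSA hHD hI h₁ h₃ hGR η hη hηc hGR₀ hGR₁ hGR₂ hGR₃ μ 𝔄 V c hV hemb hc N Γ₀ arch₀₀ harch₀ hfin₀ hχ₀ arch₀₁ harch₁ hfin₁ hχ₁
      k hk).IsPMinusKilledAlong BallForms.expP (-Complex.I • (Pi.single p 1 : Fin 2 → ℂ)) := by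
  unfold archKTypeOfSA
  split
  · next h0 =>
    subst h0
    exact isPMinusKilledAlong_archKTypeOfSAZero hHD hI h₁ h₃ hGR η hη hηc hGR₀ hGR₁ hGR₂ hGR₃ μ 𝔄 V c hV hemb hc N Γ₀ arch₀₀ harch₀
      hfin₀ hχ₀ p
  · next h0 =>
    obtain rfl : k = 1 := hk.resolve_left h0
    exact isPMinusKilledAlong_archKTypeOfSAOne hHD hI h₁ h₃ hGR η hη hηc hGR₀ hGR₁ hGR₂ hGR₃ μ 𝔄 V c hV hemb hc N Γ₀ arch₀₁ harch₁
      hfin₁ hχ₁ p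

/-- (REP) in the un-dispatched shape `IsPMinusKilled expP` restricted to E's directions is the conjunction over `p`; recorded for
consumers that still read `_r19AE`'s `hk`: along every direction `−I • e_p`. -/
theorem isPMinusKilledAlong_archKTypeOfSA_all (k : Fin 4) (hk : k = 0 ∨ k = 1) :
    ∀ p : Fin 2, (archKTypeOfSA hHD hI h₁ h₃ hGR η hη hηc hGR₀ hGR₁ hGR₂ hGR₃ μ 𝔄 V c hV hemb hc N Γ₀ arch₀₀ harch₀ hfin₀ hχ₀ arch₀₁
      harch₁ hfin₁ hχ₁ k hk).IsPMinusKilledAlong BallForms.expP (-Complex.I • (Pi.single p 1 : Fin 2 → ℂ)) :=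
  fun p => isPMinusKilledAlong_archKTypeOfSA hHD hI h₁ h₃ hGR η hη hηc hGR₀ hGR₁ hGR₂ hGR₃ μ 𝔄 V c hV hemb hc N Γ₀ arch₀₀ harch₀ hfin₀
    hχ₀ arch₀₁ harch₁ hfin₁ hχ₁ k hk p

end Dispatch

end SA

/-! ## § 5 E's binder shape: the FAMILY over all contexts (canonical representatives, oriented bit) -/

section Family

variable (hHD : exists_isReal_hodgeModel) (hI : hodgePQ_independent_of_hodgeModel)
  (h₁ : BallQuotientUniformised)  (h₃ : CMAbelianVarietyRealised)

variable
  (hGR : ∀ {L : CMField} {ι₁ : L →+* ℂ} (V : HermSpace3 L ι₁) (c : SeesawCtx L),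
    (cmSplittingDatum (L : Type) finProdFinEquiv (frameD V) (frameD_real V) (frameD_ne V) (dW c.D) (dW_real c.D)
      (dW_ne c.D)).CompatibleSplitting)
  (η : ∀ {L : CMField} {ι₁ : L →+* ℂ} (V : HermSpace3 L ι₁) (c : SeesawCtx L),
    CMAdelic (L : Type) (frameD V) × CMAdelic (L : Type) (dW c.D) →* ℂˣ)
  (hη : ∀ {L : CMField} {ι₁ : L →+* ℂ} (V : HermSpace3 L ι₁) (c : SeesawCtx L),
    ∀ γU ∈ CMRat (L : Type) (frameD V), ∀ γ ∈ CMRat (L : Type) (dW c.D), η V c (γU, γ) = 1)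
  (hηc : ∀ {L : CMField} {ι₁ : L →+* ℂ} (V : HermSpace3 L ι₁) (c : SeesawCtx L), Continuous fun p => ((η V c p : ℂˣ) : ℂ))
  (hGR₀ : ∀ {L : CMField} {ι₁ : L →+* ℂ} (V : HermSpace3 L ι₁) (c : SeesawCtx L),
    (cmSplittingDatum (L : Type) (e₁) (frameD V) (frameD_real V) (frameD_ne V) (lineVec (L : Type) (dW c.D 0))
      (fun _ => dW_real c.D 0) (fun _ => dW_ne c.D 0)).CompatibleSplitting)
  (hGR₁ : ∀ {L : CMField} {ι₁ : L →+* ℂ} (V : HermSpace3 L ι₁) (c : SeesawCtx L),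
    (cmSplittingDatum (L : Type) (e₁) (frameD V) (frameD_real V) (frameD_ne V) (lineVec (L : Type) (dW c.D 1))
      (fun _ => dW_real c.D 1) (fun _ => dW_ne c.D 1)).CompatibleSplitting)
  (hGR₂ : ∀ {L : CMField} {ι₁ : L →+* ℂ} (V : HermSpace3 L ι₁) (c : SeesawCtx L),
    (cmSplittingDatum (L : Type) (e₁) (frameD V) (frameD_real V) (frameD_ne V) (lineVec (L : Type) (dW' c.D 0))
      (fun _ => dW'_real c.D 0) (fun _ => dW'_ne c.D 0)).CompatibleSplitting)
  (hGR₃ : ∀ {L : CMField} {ι₁ : L →+* ℂ} (V : HermSpace3 L ι₁) (c : SeesawCtx L),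
    (cmSplittingDatum (L : Type) (e₁) (frameD V) (frameD_real V) (frameD_ne V) (lineVec (L : Type) (dW' c.D 1))
      (fun _ => dW'_real c.D 1) (fun _ => dW'_ne c.D 1)).CompatibleSplitting)
  (μ : ∀ {L : CMField}, SeesawCtx L → Fin 4 → NumberField.InfinitePlace L → ℤ)
  (𝔄 : ∀ {L : CMField} {ι₁ : L →+* ℂ} (V : HermSpace3 L ι₁) (c : SeesawCtx L),
    ArchLineDatum V c.D (hGR V c) (hGR₀ V c) (hGR₁ V c) (hGR₂ V c) (hGR₃ V c) (η V c) (μ c))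

/-! The residual input FAMILIES of row 12 at `SA` (each quantified over the guards `hemb`/`hc` it may use — the (D-2) discharge of `hfin₀`
needs the plane sign of a good context for Weil's majorants; every one is a statement about honest objects): -/
variable
  (Γ₀ : ∀ {L : CMField} {ι₁ : L →+* ℂ} (V : HermSpace3 L ι₁) (_c : SeesawCtx L) (_N : ℕ), Level V)
  (arch₀₀ : ∀ {L : CMField} {ι₁ : L →+* ℂ} (V : HermSpace3 L ι₁) (c : SeesawCtx L)
    (hemb : (InfinitePlace.mk ι₁).embedding = ι₁) (hc : SignRecipe.GoodCtx (orientBitι L ι₁) ι₁ c),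
    linePhi V (dW c.D 0) (dW_real c.D 0) (dW_ne c.D 0) (hpos_dW₀_SA V c hemb hc) = (𝔄 V c).Φinf 0)
  (harch₀ : ∀ {L : CMField} {ι₁ : L →+* ℂ} (V : HermSpace3 L ι₁) (c : SeesawCtx L) (hV : IsAnisotropic L V.Hm)
    (hemb : (InfinitePlace.mk ι₁).embedding = ι₁) (hc : SignRecipe.GoodCtx (orientBitι L ι₁) ι₁ c) (N : ℕ),
    ∀ a : UnitaryGroup.arch (↥(maximalRealSubfield L)) L (IsCMField.complexConj L) 3 V.Hm,
    UnitaryGroup.archAt (↥(maximalRealSubfield L)) L (IsCMField.complexConj L) 3 V.Hm (UnitaryGroup.cmPlace (L : Type) ι₁)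
        (NumberField.complexConj_smul_infinitePlace (L : Type) _) (IsCMField.complexConj_ne_one (L : Type)) a = 1 →
    ∀ ℓ, lineRepD V c.D (hGR V c) (hGR₀ V c) (hGR₁ V c) (hGR₂ V c) (hGR₃ V c) (η V c) 0
        (HodgeCM.Adelic.regimeEquiv L V.Hm hV
          (UnitaryGroup.archToAdelic (↥(maximalRealSubfield L)) L (IsCMField.complexConj L) 3 V.Hm a), 1)
        (testFun (↥(maximalRealSubfield L)) (Fin 3)
          (blockFamilyOfAt (L : Type) e₁ (frameD V) (frameD_real V) (frameD_ne V) (lineVec (L : Type) (dW c.D 0))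
            (fun _ => dW_real c.D 0) (fun _ => dW_ne c.D 0) ι₁ (blockPosEquiv V) (blockNegEquiv V)
            (posIdxEquivUnit (hpos_dW₀_SA V c hemb hc)) (negIdxEquivEmpty (hpos_dW₀_SA V c hemb hc)) (degOnePDual Empty) (binvPi 1) ℓ)
          ((𝔄 V c).x₀ 0) N) =
      testFun (↥(maximalRealSubfield L)) (Fin 3)
        (blockFamilyOfAt (L : Type) e₁ (frameD V) (frameD_real V) (frameD_ne V) (lineVec (L : Type) (dW c.D 0))
          (fun _ => dW_real c.D 0) (fun _ => dW_ne c.D 0) ι₁ (blockPosEquiv V) (blockNegEquiv V)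
          (posIdxEquivUnit (hpos_dW₀_SA V c hemb hc)) (negIdxEquivEmpty (hpos_dW₀_SA V c hemb hc)) (degOnePDual Empty) (binvPi 1) ℓ)
        ((𝔄 V c).x₀ 0) N)
  (hfin₀ : ∀ {L : CMField} {ι₁ : L →+* ℂ} (V : HermSpace3 L ι₁) (c : SeesawCtx L) (hV : IsAnisotropic L V.Hm)
    (_hemb : (InfinitePlace.mk ι₁).embedding = ι₁) (_hc : SignRecipe.GoodCtx (orientBitι L ι₁) ι₁ c) (N : ℕ),
    ∀ kf : UnitaryGroup.finAdelic (↥(maximalRealSubfield L)) L (IsCMField.complexConj L) 3 V.Hm, kf ∈ (Γ₀ V c N).K →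
    ∀ Φinf : 𝓢((Fin 3 → mixedSpace (↥(maximalRealSubfield L))), ℂ),
      lineRepD V c.D (hGR V c) (hGR₀ V c) (hGR₁ V c) (hGR₂ V c) (hGR₃ V c) (η V c) 0
          (HodgeCM.Adelic.regimeEquiv L V.Hm hV
            (UnitaryGroup.finAdelicToAdelic (↥(maximalRealSubfield L)) L (IsCMField.complexConj L) 3 V.Hm kf), 1)
          (testFun (↥(maximalRealSubfield L)) (Fin 3) Φinf ((𝔄 V c).x₀ 0) N) =
        testFun (↥(maximalRealSubfield L)) (Fin 3) Φinf ((𝔄 V c).x₀ 0) N)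
  (hχ₀ : ∀ {L : CMField} {ι₁ : L →+* ℂ} (V : HermSpace3 L ι₁) (c : SeesawCtx L)
    (hemb : (InfinitePlace.mk ι₁).embedding = ι₁) (hc : SignRecipe.GoodCtx (orientBitι L ι₁) ι₁ c),
    ∀ u : stabilizer U21 x₀,
    ((lineScalar_zero V c.D (hGR V c) (hGR₀ V c) (hGR₁ V c) (eta₀ V c.D (η V c)) (u : U21) : ℂˣ) : ℂ) *
        ((matA (stabilizerEquivK21.symm u)).det ^
            (lineVacExponentsZero V c (hGR₀ V c) (h₁W_SA c hc) (posIdxEquivUnit (hpos_dW₀_SA V c hemb hc))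
              (negIdxEquivEmpty (hpos_dW₀_SA V c hemb hc))).eP *
          sclD (stabilizerEquivK21.symm u) ^
            (lineVacExponentsZero V c (hGR₀ V c) (h₁W_SA c hc) (posIdxEquivUnit (hpos_dW₀_SA V c hemb hc))
              (negIdxEquivEmpty (hpos_dW₀_SA V c hemb hc))).eQ) =
      star (sclD (stabilizerEquivK21.symm u)))
  (arch₀₁ : ∀ {L : CMField} {ι₁ : L →+* ℂ} (V : HermSpace3 L ι₁) (c : SeesawCtx L)
    (hemb : (InfinitePlace.mk ι₁).embedding = ι₁) (hc : SignRecipe.GoodCtx (orientBitι L ι₁) ι₁ c),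
    linePhi V (dW c.D 1) (dW_real c.D 1) (dW_ne c.D 1) (hpos_dW₁_SA V c hemb hc) = (𝔄 V c).Φinf 1)
  (harch₁ : ∀ {L : CMField} {ι₁ : L →+* ℂ} (V : HermSpace3 L ι₁) (c : SeesawCtx L) (hV : IsAnisotropic L V.Hm)
    (hemb : (InfinitePlace.mk ι₁).embedding = ι₁) (hc : SignRecipe.GoodCtx (orientBitι L ι₁) ι₁ c) (N : ℕ),
    ∀ a : UnitaryGroup.arch (↥(maximalRealSubfield L)) L (IsCMField.complexConj L) 3 V.Hm,
    UnitaryGroup.archAt (↥(maximalRealSubfield L)) L (IsCMField.complexConj L) 3 V.Hm (UnitaryGroup.cmPlace (L : Type) ι₁)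
        (NumberField.complexConj_smul_infinitePlace (L : Type) _) (IsCMField.complexConj_ne_one (L : Type)) a = 1 →
    ∀ ℓ, lineRepD V c.D (hGR V c) (hGR₀ V c) (hGR₁ V c) (hGR₂ V c) (hGR₃ V c) (η V c) 1
        (HodgeCM.Adelic.regimeEquiv L V.Hm hV
          (UnitaryGroup.archToAdelic (↥(maximalRealSubfield L)) L (IsCMField.complexConj L) 3 V.Hm a), 1)
        (testFun (↥(maximalRealSubfield L)) (Fin 3)
          (blockFamilyOfAt (L : Type) e₁ (frameD V) (frameD_real V) (frameD_ne V) (lineVec (L : Type) (dW c.D 1))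
            (fun _ => dW_real c.D 1) (fun _ => dW_ne c.D 1) ι₁ (blockPosEquiv V) (blockNegEquiv V)
            (posIdxEquivUnit (hpos_dW₁_SA V c hemb hc)) (negIdxEquivEmpty (hpos_dW₁_SA V c hemb hc)) (degOnePDual Empty) (binvPi 1) ℓ)
          ((𝔄 V c).x₀ 1) N) =
      testFun (↥(maximalRealSubfield L)) (Fin 3)
        (blockFamilyOfAt (L : Type) e₁ (frameD V) (frameD_real V) (frameD_ne V) (lineVec (L : Type) (dW c.D 1))
          (fun _ => dW_real c.D 1) (fun _ => dW_ne c.D 1) ι₁ (blockPosEquiv V) (blockNegEquiv V)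
          (posIdxEquivUnit (hpos_dW₁_SA V c hemb hc)) (negIdxEquivEmpty (hpos_dW₁_SA V c hemb hc)) (degOnePDual Empty) (binvPi 1) ℓ)
        ((𝔄 V c).x₀ 1) N)
  (hfin₁ : ∀ {L : CMField} {ι₁ : L →+* ℂ} (V : HermSpace3 L ι₁) (c : SeesawCtx L) (hV : IsAnisotropic L V.Hm)
    (_hemb : (InfinitePlace.mk ι₁).embedding = ι₁) (_hc : SignRecipe.GoodCtx (orientBitι L ι₁) ι₁ c) (N : ℕ),
    ∀ kf : UnitaryGroup.finAdelic (↥(maximalRealSubfield L)) L (IsCMField.complexConj L) 3 V.Hm, kf ∈ (Γ₀ V c N).K →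
    ∀ Φinf : 𝓢((Fin 3 → mixedSpace (↥(maximalRealSubfield L))), ℂ),
      lineRepD V c.D (hGR V c) (hGR₀ V c) (hGR₁ V c) (hGR₂ V c) (hGR₃ V c) (η V c) 1
          (HodgeCM.Adelic.regimeEquiv L V.Hm hV
            (UnitaryGroup.finAdelicToAdelic (↥(maximalRealSubfield L)) L (IsCMField.complexConj L) 3 V.Hm kf), 1)
          (testFun (↥(maximalRealSubfield L)) (Fin 3) Φinf ((𝔄 V c).x₀ 1) N) =
        testFun (↥(maximalRealSubfield L)) (Fin 3) Φinf ((𝔄 V c).x₀ 1) N)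
  (hχ₁ : ∀ {L : CMField} {ι₁ : L →+* ℂ} (V : HermSpace3 L ι₁) (c : SeesawCtx L)
    (hemb : (InfinitePlace.mk ι₁).embedding = ι₁) (hc : SignRecipe.GoodCtx (orientBitι L ι₁) ι₁ c),
    ∀ u : stabilizer U21 x₀,
    ((lineScalar_one V c.D (hGR V c) (hGR₀ V c) (hGR₁ V c) (eta₁ V c.D (η V c)) (u : U21) : ℂˣ) : ℂ) *
        ((matA (stabilizerEquivK21.symm u)).det ^
            (lineVacExponentsOne V c (hGR₁ V c) (h₁W_SA c hc) (posIdxEquivUnit (hpos_dW₁_SA V c hemb hc))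
              (negIdxEquivEmpty (hpos_dW₁_SA V c hemb hc))).eP *
          sclD (stabilizerEquivK21.symm u) ^
            (lineVacExponentsOne V c (hGR₁ V c) (h₁W_SA c hc) (posIdxEquivUnit (hpos_dW₁_SA V c hemb hc))
              (negIdxEquivEmpty (hpos_dW₁_SA V c hemb hc))).eQ) =
      star (sclD (stabilizerEquivK21.symm u)))

/-- **ROW 12 AS A FAMILY — E's binder `C` at `S := SInstance.SA …` for canonical representatives and good contexts of the oriented bit**,
from the nine residual input families {`Γ₀`, `arch₀₀/₀₁`, `harch₀/₁`, `hfin₀/₁`, `hχ₀/₁`} (E's shape up to the two guards `hemb`/`hc`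
and `β`; `h6`, `hN` are carried unused, as in E). -/
def archKTypeOfSAFamily :
    ∀ {L : CMField} {ι₁ : L →+* ℂ} (V : HermSpace3 L ι₁) (c : SeesawCtx L) (hV : IsAnisotropic L V.Hm),
      (InfinitePlace.mk ι₁).embedding = ι₁ → SignRecipe.GoodCtx (orientBitι L ι₁) ι₁ c → Module.finrank ℚ c.K = 6 →
      ∀ k : Fin 4, k = 0 ∨ k = 1 → ∀ N : ℕ, 0 < N →
        ArchKTypeData (thetaSpaceInputIn hHD hI h₁ h₃ (SInstance.SA @hGR @η @hη @hηc @hGR₀ @hGR₁ @hGR₂ @hGR₃ @μ @𝔄 V c) hV) k N :=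
  fun V c hV hemb hc _h6 k hk N _hN =>
    archKTypeOfSA hHD hI h₁ h₃ hGR η hη hηc hGR₀ hGR₁ hGR₂ hGR₃ μ 𝔄 V c hV hemb hc N (Γ₀ V c N) (arch₀₀ V c hemb hc)
      (harch₀ V c hV hemb hc N) (hfin₀ V c hV hemb hc N) (hχ₀ V c hemb hc) (arch₀₁ V c hemb hc) (harch₁ V c hV hemb hc N) (hfin₁ V c hV hemb hc N)
      (hχ₁ V c hemb hc) k hk

/-- **ROW 14 (`hpd`) for the family — a THEOREM** (E's binder shape with the two guards). -/
theorem isWeaklyPDiff_archKTypeOfSAFamily :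
    ∀ {L : CMField} {ι₁ : L →+* ℂ} (V : HermSpace3 L ι₁) (c : SeesawCtx L) (hV : IsAnisotropic L V.Hm)
      (hemb : (InfinitePlace.mk ι₁).embedding = ι₁) (hc : SignRecipe.GoodCtx (orientBitι L ι₁) ι₁ c) (h6 : Module.finrank ℚ c.K = 6)
      (k : Fin 4) (hk : k = 0 ∨ k = 1) (N : ℕ) (hN : 0 < N),
      (archKTypeOfSAFamily hHD hI h₁ h₃ hGR η hη hηc hGR₀ hGR₁ hGR₂ hGR₃ μ 𝔄 Γ₀ arch₀₀ harch₀ hfin₀ hχ₀ arch₀₁ harch₁ hfin₁ hχ₁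
        V c hV hemb hc h6 k hk N hN).IsWeaklyPDiff BallForms.expP :=
  fun V c hV hemb hc _ k hk N _ =>
    isWeaklyPDiff_archKTypeOfSA hHD hI h₁ h₃ hGR η hη hηc hGR₀ hGR₁ hGR₂ hGR₃ μ 𝔄 V c hV hemb hc N (Γ₀ V c N) (arch₀₀ V c hemb hc)
      (harch₀ V c hV hemb hc N) (hfin₀ V c hV hemb hc N) (hχ₀ V c hemb hc) (arch₀₁ V c hemb hc) (harch₁ V c hV hemb hc N) (hfin₁ V c hV hemb hc N)
      (hχ₁ V c hemb hc) k hk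

/-- **ROW 15 (`hk`, `_r20AE`'s Along shape) for the family — a THEOREM.** -/
theorem isPMinusKilledAlong_archKTypeOfSAFamily :
    ∀ {L : CMField} {ι₁ : L →+* ℂ} (V : HermSpace3 L ι₁) (c : SeesawCtx L) (hV : IsAnisotropic L V.Hm)
      (hemb : (InfinitePlace.mk ι₁).embedding = ι₁) (hc : SignRecipe.GoodCtx (orientBitι L ι₁) ι₁ c) (h6 : Module.finrank ℚ c.K = 6)
      (k : Fin 4) (hk : k = 0 ∨ k = 1) (N : ℕ) (hN : 0 < N) (p : Fin 2),
      (archKTypeOfSAFamily hHD hI h₁ h₃ hGR η hη hηc hGR₀ hGR₁ hGR₂ hGR₃ μ 𝔄 Γ₀ arch₀₀ harch₀ hfin₀ hχ₀ arch₀₁ harch₁ hfin₁ hχ₁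
        V c hV hemb hc h6 k hk N hN).IsPMinusKilledAlong BallForms.expP (-Complex.I • (Pi.single p 1 : Fin 2 → ℂ)) :=
  fun V c hV hemb hc _ k hk N _ p =>
    isPMinusKilledAlong_archKTypeOfSA hHD hI h₁ h₃ hGR η hη hηc hGR₀ hGR₁ hGR₂ hGR₃ μ 𝔄 V c hV hemb hc N (Γ₀ V c N) (arch₀₀ V c hemb hc)
      (harch₀ V c hV hemb hc N) (hfin₀ V c hV hemb hc N) (hχ₀ V c hemb hc) (arch₀₁ V c hemb hc) (harch₁ V c hV hemb hc N) (hfin₁ V c hV hemb hc N)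
      (hχ₁ V c hemb hc) k hk p

end Family


end HodgeCM.Model

end
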